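import Literature.NumberTheory.LFunctions.TwistedZeroFreeRegion
import HarnessLib

/-!
# Upper bounds for `Re L(Λ, s)` to the right of `σ = 1` from a growth package

A small companion of `TwistedZeroFreeRegion`: the part of the datum `TwistedZFRData` that concerns
ONE function `F` (holomorphic on `σ > 1 − η`, non-vanishing with `F'/F = −L(Λ, ·)` on `σ > 1`,
growth `|F| ≤ C_g Q^A (|t|+4)^A`, lower bound `c₁(σ−1) ≤ |F|`) is isolated as `LogDerivPackage`, and
the third inequality of Montgomery–Vaughan (11.2),
`Re L(Λ, 1 + δ + it) ≤ E (log Q + log(|t| + 4))` (`0 < δ ≤ 3η/32`, `E = E(η, A, C_g, c₁)`), is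
re-derived for it (`re_LSeries_le`), together with the version on the whole strip `1 < σ ≤ 2` given a
non-negative majorant `Λ₀` with `Re L(Λ₀, σ) ≤ 1/(σ−1) + K₀` (`re_LSeries_le_of_majorant`).

Purpose: the field `re_LSeries₂_le` of `TwistedZFRData` for a twisted `L`-function `L(s, ν)` asks
for this bound for the COMPANION function `L(s, ν²)`; when `ν²` is non-trivial it is supplied by the
package of `L(s, ν²)` through the present file (the pole case is the Dedekind zeta function). Used for
T. Mitsui's prime number theorem with Grössencharakteren (Heath-Brown 2001, Lemma 9.4).
All statements are PROVED; the only definition is the `Prop`-valued structure `LogDerivPackage`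
(a conjunction of hypotheses, like `TwistedZFRData`), not a named fact.

## References

* H. L. Montgomery, R. C. Vaughan, *Multiplicative Number Theory I*, CUP 2007, §11.1, Lemma 11.1 and
  Theorem 11.3 (proof, (11.2)). [cite: MontgomeryVaughan2007, §11.1 Theorem 11.3]
* D. R. Heath-Brown, *Primes represented by `x³ + 2y³`*, Acta Math. 186 (2001), Lemma 9.4.
  [cite: HeathBrownActa2001, Lemma 9.4]

## Mathlib / tree search

Tree: `TwistedZFRData.exists_package`, `TwistedZFRData.re_LSeries₁_le` (same proofs, bundled with
the 3-4-1 data there), `Literature.Analysis.Complex.titchmarsh_logDeriv_sub_sum_of_differentiableOn`,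
`ClassicalZFRData.re_sum_div_ge`, `TwistedZFR.norm_LSeries_le_of_norm_le`, `TwistedZFR.one_le_ell`.
-/

noncomputable section

open Complex Filter Topology Metric Set Finset

namespace Literature.NumberTheory.LFunctions

/-- **Growth package of one `L`-function** `F` with Dirichlet coefficients of `−F'/F` equal to `Λ`:
the one-function part of `TwistedZFRData` (conductor `Q ≥ 1`, exponent `A`, constants `η, C_g, c₁`).
[cite: MontgomeryVaughan2007, §11.1 Lemma 11.1 (hypotheses)] -/
structure LogDerivPackage (η A Cg c₁ Q : ℝ) (Λ : ℕ → ℂ) (F : ℂ → ℂ) : Prop where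
  eta_pos : 0 < η
  eta_le_one : η ≤ 1
  A_nonneg : 0 ≤ A
  Cg_pos : 0 < Cg
  c₁_pos : 0 < c₁
  one_le_Q : 1 ≤ Q
  /-- `F` is holomorphic on `σ > 1 − η`. -/
  differentiableOn : DifferentiableOn ℂ F {s : ℂ | 1 - η < s.re}
  /-- `F ≠ 0` on `σ > 1`. -/
  ne_zero : ∀ s : ℂ, 1 < s.re → F s ≠ 0
  /-- `F'/F = −L(Λ, ·)` on `σ > 1`. -/
  logDeriv_eq : ∀ s : ℂ, 1 < s.re → deriv F s / F s = -LSeries Λ s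
  /-- `|F(s)| ≤ C_g Q^A (|t|+4)^A` for `1 − η < σ ≤ 3`. -/
  growth : ∀ s : ℂ, 1 - η < s.re → s.re ≤ 3 → ‖F s‖ ≤ Cg * Q ^ A * (|s.im| + 4) ^ A
  /-- `c₁ (σ − 1) ≤ |F(s)|` for `1 < σ ≤ 2`. -/
  lower : ∀ s : ℂ, 1 < s.re → s.re ≤ 2 → c₁ * (s.re - 1) ≤ ‖F s‖

/-- A `TwistedZFRData` contains the growth package of its `F`. [folklore] -/
theorem TwistedZFRData.toLogDerivPackage {η A Cg c₁ K₀ C₂ : ℝ} {pole : Bool} {Q : ℝ} {Λ₀ : ℕ → ℝ}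
    {Λ₁ Λ₂ : ℕ → ℂ} {F : ℂ → ℂ} (h : TwistedZFRData η A Cg c₁ K₀ C₂ pole Q Λ₀ Λ₁ Λ₂ F) :
    LogDerivPackage η A Cg c₁ Q Λ₁ F :=
  ⟨h.eta_pos, h.eta_le_one, h.A_nonneg, h.Cg_pos, h.c₁_pos, h.one_le_Q, h.differentiableOn, h.ne_zero,
    h.logDeriv_eq, h.growth, h.lower⟩

namespace LogDerivPackage

variable {η A Cg c₁ Q : ℝ} {Λ : ℕ → ℂ} {F : ℂ → ℂ}

/-- Local notation for `E(η, A, C_g, c₁) = 8(2A + |log(32C_g/(c₁η))| + 1)/(η/4)`. -/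
local notation3 "E[" η "," A "," Cg "," c₁ "]" =>
  (8 * (2 * (A : ℝ) + |Real.log ((Cg : ℝ) / ((c₁ : ℝ) * ((η : ℝ) / 32)))| + 1) / ((η : ℝ) / 4))

variable (h : LogDerivPackage η A Cg c₁ Q Λ F)
include h

/-- A zero of `F` has real part `≤ 1`. [folklore] -/
theorem re_le_one_of_zero {a : ℂ} (ha : F a = 0) : a.re ≤ 1 := by
  by_contra hcon
  exact h.ne_zero a (not_le.1 hcon) ha

/-- `0 ≤ E(η, A, C_g, c₁)`. [folklore] -/
theorem packageConst_nonneg : 0 ≤ E[η, A, Cg, c₁] := by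
  have hη := h.eta_pos
  have hA := h.A_nonneg
  positivity

/-- **The local package at height `t`** (MV Lemma 11.1 for `F`): zeros `S` in `|z − c| ≤ η/4`,
`c = 1 + η/32 + it`, multiplicities, and `F'/F = ∑ m(a)/(z−a) + ψ` with
`|ψ| ≤ E (log Q + log(|t|+4))` on `|z − c| ≤ η/16`. [cite: MontgomeryVaughan2007, Lemma 11.1] -/
theorem exists_package (t : ℝ) :
    ∃ (S : Finset ℂ) (m : ℂ → ℕ) (ψ : ℂ → ℂ),
      (∀ a ∈ S, F a = 0 ∧ 0 < m a ∧ ‖a - (1 + η / 32 + t * I)‖ ≤ η / 4) ∧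
      (∀ a, F a = 0 → ‖a - (1 + η / 32 + t * I)‖ ≤ η / 4 → a ∈ S) ∧
      (∀ z ∈ ball (1 + η / 32 + t * I) (η / 4), F z ≠ 0 →
        ψ z = deriv F z / F z - ∑ a ∈ S, (m a : ℂ) / (z - a)) ∧
      (∀ z ∈ closedBall (1 + η / 32 + t * I) (η / 16),
        ‖ψ z‖ ≤ E[η, A, Cg, c₁] * (Real.log Q + Real.log (|t| + 4))) := by
  have hη := h.eta_pos
  have hη1 := h.eta_le_one
  have hA := h.A_nonneg
  have hCg := h.Cg_pos
  have hc₁ := h.c₁_pos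
  have hQ := h.one_le_Q
  set R : ℝ := η / 4 with hR
  have hRpos : 0 < R := by positivity
  set g₀ : ℝ := c₁ * (η / 32) with hg₀
  have hg₀pos : 0 < g₀ := by positivity
  set c : ℂ := 1 + η / 32 + t * I with hc
  have hcre : c.re = 1 + η / 32 := by simp [hc]
  have hcim : c.im = t := by simp [hc]
  have hcentre : g₀ ≤ ‖F c‖ := by
    have h1 := h.lower c (by rw [hcre]; linarith) (by rw [hcre]; linarith)
    rw [hcre] at h1
    rw [hg₀]
    linarith
  have hFc : F c ≠ 0 := norm_pos_iff.1 (hg₀pos.trans_le hcentre)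
  have hdiff : DifferentiableOn ℂ F (ball c η) := by
    refine h.differentiableOn.mono fun z hz ↦ ?_
    simp only [Set.mem_setOf_eq]
    have h1 : |(z - c).re| ≤ ‖z - c‖ := abs_re_le_norm _
    rw [mem_ball_iff_norm] at hz
    rw [Complex.sub_re, hcre] at h1
    have := neg_abs_le (z.re - (1 + η / 32))
    linarith
  set M : ℝ := Cg * Q ^ A * (|t| + 5) ^ A with hM
  have hQA : 1 ≤ Q ^ A := Real.one_le_rpow hQ hA
  have hMpos : 0 < M := by positivity
  have hMbound : ∀ z ∈ closedBall c (2 * R), ‖F z‖ ≤ M := by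
    intro z hz
    rw [mem_closedBall_iff_norm] at hz
    have h1 : |(z - c).re| ≤ ‖z - c‖ := abs_re_le_norm _
    have h2 : |(z - c).im| ≤ ‖z - c‖ := abs_im_le_norm _
    rw [Complex.sub_re, hcre] at h1
    rw [Complex.sub_im, hcim] at h2
    have hre1 : 1 - η < z.re := by
      have := neg_abs_le (z.re - (1 + η / 32)); rw [hR] at hz; linarith
    have hre2 : z.re ≤ 3 := by
      have := le_abs_self (z.re - (1 + η / 32)); rw [hR] at hz; linarith
    refine (h.growth z hre1 hre2).trans ?_
    rw [hM]
    have him : |z.im| + 4 ≤ |t| + 5 := by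
      have := abs_sub_abs_le_abs_sub z.im t
      rw [hR] at hz; linarith
    exact mul_le_mul_of_nonneg_left (Real.rpow_le_rpow (by positivity) him hA) (by positivity)
  obtain ⟨S, m, ψ, hS, hS', -, hψ, hψb, -⟩ :=
    Literature.Analysis.Complex.titchmarsh_logDeriv_sub_sum_of_differentiableOn hdiff
      (by rw [hR]; linarith) hFc hRpos hMbound
  refine ⟨S, m, ψ, ?_, ?_, ?_, fun z hz ↦ ?_⟩
  · simpa only [hR] using hS
  · simpa only [hR] using hS'
  · simpa only [hR] using hψ
  have hz' : z ∈ closedBall c (R / 4) := by rw [hR]; convert hz using 2; ring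
  refine (hψb z hz').trans ?_
  set B : ℝ := |Real.log (Cg / g₀)| with hB
  set ℒ : ℝ := Real.log Q + Real.log (|t| + 4) with hℒ
  have hℒ1 : 1 ≤ ℒ := TwistedZFR.one_le_ell hQ t
  have hlogQ : 0 ≤ Real.log Q := Real.log_nonneg hQ
  have hτ := ClassicalZFRData.one_le_log_tau t
  have hlogM : Real.log (M / ‖F c‖) ≤ (2 * A + B) * ℒ := by
    have hGc : 0 < ‖F c‖ := hg₀pos.trans_le hcentre
    have hMle : M / ‖F c‖ ≤ Q ^ A * (|t| + 5) ^ A * (Cg / g₀) := by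
      rw [hM, div_le_iff₀ hGc]
      calc Cg * Q ^ A * (|t| + 5) ^ A = Q ^ A * (|t| + 5) ^ A * (Cg / g₀) * g₀ := by field_simp
        _ ≤ Q ^ A * (|t| + 5) ^ A * (Cg / g₀) * ‖F c‖ := by gcongr
    have hMpos' : 0 < M / ‖F c‖ := div_pos hMpos hGc
    calc Real.log (M / ‖F c‖) ≤ Real.log (Q ^ A * (|t| + 5) ^ A * (Cg / g₀)) :=
          Real.log_le_log hMpos' hMle
      _ = A * Real.log Q + A * Real.log (|t| + 5) + Real.log (Cg / g₀) := by
          rw [Real.log_mul (by positivity) (by positivity), Real.log_mul (by positivity) (by positivity),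
            Real.log_rpow (by linarith), Real.log_rpow (by positivity)]
      _ ≤ A * Real.log Q + A * (2 * Real.log (|t| + 4)) + B * 1 := by
          gcongr
          · calc Real.log (|t| + 5) ≤ Real.log (2 * (|t| + 4)) :=
                  Real.log_le_log (by positivity) (by linarith [abs_nonneg t])
              _ ≤ 2 * Real.log (|t| + 4) := ClassicalZFRData.log_two_mul_tau_le t
          · rw [mul_one]; exact le_abs_self _
      _ ≤ (2 * A + B) * ℒ := by
          rw [hℒ]
          have hB0 : 0 ≤ B := abs_nonneg _
          nlinarith
  have hfinal : 8 * (Real.log (M / ‖F c‖) + 1) / R ≤ 8 * (2 * A + B + 1) / R * ℒ := by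
    calc 8 * (Real.log (M / ‖F c‖) + 1) / R ≤ 8 * ((2 * A + B) * ℒ + 1 * ℒ) / R := by
          gcongr; simpa using hℒ1
      _ = 8 * (2 * A + B + 1) / R * ℒ := by ring
  convert hfinal using 2

/-- **MV (11.2), third inequality, for a growth package**: for `0 < δ ≤ 3η/32` and real `t`,
`Re L(Λ, 1 + δ + it) ≤ E (log Q + log(|t| + 4))`. [cite: MontgomeryVaughan2007, Theorem 11.3 (proof, eq. (11.2))] -/
theorem re_LSeries_le {d : ℝ} (hd : 0 < d) (hd1 : d ≤ 3 * η / 32) (t : ℝ) :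
    (LSeries Λ (((1 + d : ℝ) : ℂ) + t * I)).re ≤ E[η, A, Cg, c₁] * (Real.log Q + Real.log (|t| + 4)) := by
  have hη := h.eta_pos
  obtain ⟨S, m, ψ, hS, -, hψ, hψb⟩ := h.exists_package t
  set s₀ : ℂ := ((1 + d : ℝ) : ℂ) + t * I with hs₀
  have hs₀re : s₀.re = 1 + d := by simp [hs₀]
  have hs₀1 : 1 < s₀.re := by rw [hs₀re]; linarith
  set c : ℂ := 1 + η / 32 + t * I with hcdef
  have hs₀c : ‖s₀ - c‖ ≤ η / 16 := by
    have : s₀ - c = ((d - η / 32 : ℝ) : ℂ) := by simp only [hs₀, hcdef]; push_cast; ring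
    rw [this, Complex.norm_real, Real.norm_eq_abs, abs_le]
    constructor <;> linarith
  have hs₀ball : s₀ ∈ ball c (η / 4) := mem_ball_iff_norm.2 (by linarith)
  have hs₀cl : s₀ ∈ closedBall c (η / 16) := mem_closedBall_iff_norm.2 hs₀c
  have hFs₀ : F s₀ ≠ 0 := h.ne_zero s₀ hs₀1
  have hψs₀ := hψ s₀ hs₀ball hFs₀
  have hSre : ∀ a ∈ S, a.re < s₀.re := by
    intro a ha
    have := h.re_le_one_of_zero (hS a ha).1
    rw [hs₀re]; linarith
  obtain ⟨hnn, -⟩ := ClassicalZFRData.re_sum_div_ge (m := m) hSre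
  have hL : LSeries Λ s₀ = -(ψ s₀ + ∑ a ∈ S, (m a : ℂ) / (s₀ - a)) := by
    rw [hψs₀, h.logDeriv_eq s₀ hs₀1]; ring
  rw [hL, Complex.neg_re, Complex.add_re]
  have := (Complex.abs_re_le_norm (ψ s₀)).trans (hψb s₀ hs₀cl)
  linarith [neg_abs_le (ψ s₀).re, le_abs_self (ψ s₀).re]

omit h in
/-- **The bound on the whole strip `1 < σ ≤ 2`** given a non-negative majorant: if `‖Λ‖ ≤ Λ₀`
termwise, `L(Λ₀, σ)` converges for `σ > 1` with `Re L(Λ₀, σ) ≤ 1/(σ−1) + K₀` (`1 < σ ≤ 2`), then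
`Re L(Λ, s) ≤ (E + 32/(3η) + K₀)(log Q + log(|t|+4))` for `1 < σ ≤ 2` (near the line by
`re_LSeries_le`, away from it by the trivial bound). This is the field `re_LSeries₂_le` of
`TwistedZFRData` (no-pole case) for the companion function.
[cite: MontgomeryVaughan2007, Theorem 11.3 (proof, eq. (11.2))] -/
theorem re_LSeries_le_of_majorant (h : LogDerivPackage η A Cg c₁ Q Λ F) {Λ₀ : ℕ → ℝ} {K₀ : ℝ}
    (hK₀ : 0 ≤ K₀) (hmaj : ∀ n, ‖Λ n‖ ≤ Λ₀ n)
    (hsum : ∀ s : ℂ, 1 < s.re → LSeriesSummable (fun n ↦ (Λ₀ n : ℂ)) s)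
    (h0 : ∀ σ : ℝ, 1 < σ → σ ≤ 2 → (LSeries (fun n ↦ (Λ₀ n : ℂ)) σ).re ≤ 1 / (σ - 1) + K₀)
    (s : ℂ) (hs : 1 < s.re) (hs2 : s.re ≤ 2) :
    (LSeries Λ s).re ≤ (E[η, A, Cg, c₁] + 32 / (3 * η) + K₀) * (Real.log Q + Real.log (|s.im| + 4)) := by
  have hη := h.eta_pos
  have hQ := h.one_le_Q
  have hE := h.packageConst_nonneg
  have hℒ1 : 1 ≤ Real.log Q + Real.log (|s.im| + 4) := TwistedZFR.one_le_ell hQ s.im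
  by_cases hd : s.re - 1 ≤ 3 * η / 32
  · have hs' : s = ((1 + (s.re - 1) : ℝ) : ℂ) + s.im * I := by
      apply Complex.ext <;> simp
    have h1 := h.re_LSeries_le (d := s.re - 1) (by linarith) hd s.im
    rw [← hs'] at h1
    refine h1.trans ?_
    have : 0 ≤ (32 / (3 * η) + K₀) * (Real.log Q + Real.log (|s.im| + 4)) := by positivity
    nlinarith
  · rw [not_le] at hd
    have hσ : 1 < s.re := hs
    have htriv : (LSeries Λ s).re ≤ 1 / (s.re - 1) + K₀ := by
      have h1 := TwistedZFR.norm_LSeries_le_of_norm_le hmaj hsum (s := s) hσ le_rfl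
      have h2 := h0 s.re hσ hs2
      have h3 := Complex.re_le_norm (LSeries Λ s)
      have : ((s.re : ℝ) : ℂ) = (s.re : ℂ) := rfl
      linarith
    have hinv : 1 / (s.re - 1) ≤ 32 / (3 * η) := by
      rw [div_le_div_iff₀ (by linarith) (by positivity)]
      nlinarith
    calc (LSeries Λ s).re ≤ 32 / (3 * η) + K₀ := by linarith
      _ ≤ (32 / (3 * η) + K₀) * (Real.log Q + Real.log (|s.im| + 4)) := by
          have : 0 ≤ 32 / (3 * η) + K₀ := by positivity
          nlinarith
      _ ≤ _ := by
          have : 0 ≤ E[η, A, Cg, c₁] * (Real.log Q + Real.log (|s.im| + 4)) := by positivity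
          nlinarith

end LogDerivPackage

end Literature.NumberTheory.LFunctions
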